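import Summits.QuantumFields.YangMills.Theorems.BalabanUVNodesK0Stub1MultiplierLetterAtRecord
import Summits.QuantumFields.YangMills.Theorems.BalabanUVNodesK0Stub1MultiplierNormalisation
import HarnessLib

/-!
# K0⁷ STUB 1 (`stub_prop8StepCoP13`), sub-target S4b — **THE `O₁` LETTER FOR THE NORMALISED MULTIPLIER `η^d•M_V` AT NODE 00's CARRIER**:
# the (3.132)-shaped sup letter `h3132` of the S4b capstone at the record (`K0Stub1SectFWSlotAtRecord.exists_sectF_W_atRecord_of_numericLetters`,
# p612123: `(∀ i, 1·‖X i‖ ≤ s) → ∀ i, wB′ i·‖(MV X) i‖ ≤ O₁·s`) DISCHARGED for `MV := η^d • M_V`, `M_V` = p598821's componentwise extension of print's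
# `(QGQ*)⁻¹ − a = EE D − aE D w`, at EVERY admissible family of the record's four-tori, for every output block weight `wB′` with `0 ≤ wB′(t) ≤ (L^{j(t)}η)⁻¹`
# (so for `wB′ ≡ 1` and for `wB′(t) = (L^{j(t)}η)⁻¹`), with ONE constant `O₁` depending on `L` only

Cell `pub-ymgap`, width seat `pub-ymgap-k0-s1-w4` g0′ (FILE 4 of the seat; HOME `pub-ymgap-k0-s1-w4/HANDOFF.md` trigger (t2); TABLE v66 row k0-s1 «ANSWER-OFFER-1 →
k0-s1-w4: O₁ for M_V»).  `--kind proof --supports stmt-QuantumFields-20541 --as helper`; count-neutral.  [15] = [Balaban1985Variational]; [B6] = [Balaban1984PropagatorsII].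

WHY.  The capstone estimates its multiplier term `Qᵗ(M(D A′))` through two displayed numbers `O₁` (for `M`: input block weight `1`, output block weight `wB′`)
and `q₀` (for `Qᵗ`); the multiplier of record is `η^d•M_V` (p612514 `BE_curlCurlHV_eq_B_smul_MV`).  Print's estimate behind `O₁` is [B6] Prop. 2.7 (2.149)
`|(QGQ*)⁻¹(b,b′)| ≤ O(1)(Lʲη)^{(d−2)/2}(L^{j′}η)^{(d−2)/2}η^{−d}e^{−δ₄d(b,b′)}` (lit-balaban `B6Prop27KLevelV1L0.prop27_kLevel`, hypothesis-free through the port pad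
`FlatPortProp27PadL0.prop27_kLevel_pad`) + Lemma 2.1's row sum on the torus (`lemma21_torus`, `sumBound_torus`, fibre count `rho_sumBound`); the diagonal `a` is
`(Lʲη)^{d−2}η^{−d}` at the port's band weights, and `(QGQ*)⁻¹ − a` does not depend on the auxiliary weights (p612514 `EE_sub_aE_eq_of_weights`), so the row sum
holds for the `M_V` built at ANY weights — in particular the capstone inhabitant's `a ≡ 1`.

WHAT IS PROVED (sorry-free; no definition; axioms standard).
* §0 bookkeeping: `sq_weight_eta_invWt_le`, `weight_eta_invLam_le` (`v·η^{D}Λ_t⁻¹Λ_s⁻¹ ≤ 1` for `v²(L^{j_t}η)^{D−2} ≤ 1`), `weight_eta_band_le` (`v·η^{D}a(t) ≤ 1`),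
  `norm_kernel_smul_sum_le`; §1 `abs_kernel_sub_diag_le` (`|((E − a)e_s)(t)| ≤ |⟪e_t,Ee_s⟫| + a_s·[t = s]`).
* §1 ★★ `multiplierRowSum_domT` — at every charted family `domT hN D hk` of the tori `PV d ℓ m K` (dimension `D = d + 1 ≥ 2`, odd `L = ℓ + 1 ≥ 5`): thresholds `Mh₀, R₀`
  and ONE constant `O₁ ≥ 0` (function of `d, L`) such that in the standing range, for ANY positive auxiliary weights `w` and every output weight `v ≥ 0` with
  `v(t)²·(L^{j(t)}η)^{d−1} ≤ 1`: `v(t)·η^{D}·Σ_s |((EE − aE w)e_s)(t)| ≤ O₁` for every index bond `t` (`η = L^{−(K−n)}`).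
* §2 ★★ `multiplierRowSum_of_adm22` — the same at EVERY `Adm22 D R (L·M_h)` family of the P2 text (level-0 chart `FlatPortChartL0.tdOfAdmL0`).
* §3 `multiplierRowSum_of_adm22_T4` (the record's tori, `d = 4`: band `v(t)·(L^{j(t)}η) ≤ 1`), `smul_multiplier_symm` (`η^d•M_V` is `B`-symmetric with `M_V`) and
  ★★★ `h3132_of_adm22_T4` ∕ ★★★ `h3132_unitWeight_of_adm22_T4` — the capstone's `h3132` binder AS DISPLAYED (`(∀ i, 1·‖X i‖ ≤ s) → ∀ t, wB′ t·‖((η^d•M_V) X) t‖ ≤ O₁·s`)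
  for every `𝔸`-valued block datum (`𝔸` any normed `ℂ`-space, e.g. `M_N(ℂ)`), every continuous linear `M_V` with p598821's kernel formula (`c = L^{K−n}`, any
  auxiliary weights `w > 0` — the inhabitant's `w ≡ 1` included), every `wB′` in the band resp. `wB′ ≡ 1`.
HONEST SCOPE.  Bookkeeping over lit-balaban's hypothesis-free k-level [B6] theorems (Prop. 2.7 (2.149), Lemma 2.1) through k0-s1-w3's port pads; the symmetric split
of the length factors is the one of `B6Prop27KLevelV1L0` (the one-sided factor via (2.60) is NOT claimed, hence the band `wB′ ≤ (Lʲη)^{−(d−2)/2}`); `q₀`, `θ₀`, `h₀`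
are NOT touched; nothing of Bałaban's analysis asserted beyond the cited kernel theorems; `stub_prop8StepCoP13` ∕ K0⁷ NOT closed; N07 NOT discharged; counts unmoved
(28∕28 · 5∕27); R4 closes the conditional finite-𝕋⁴ rung `BalabanLadder.UV` only, never the summit; the YM mass gap (Clay) is NOT proved by any of this; nothing
continuum ∕ ℝ⁴ ∕ OS.  No `sorry`, no `def`, no `instance`, no `notation`.
References: [B6] (2.16) p.225, (2.35) p.228, Lemma 2.1 (2.59)–(2.61) pp.233–234, (2.81) p.237, (2.142)–(2.149) pp.248–249; [15] (27) p.282, (66) p.287, (87)–(88) p.291;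
[Balaban1983RegularityDecay] Sect. 5 (5.6)–(5.9) pp.594–595; [Balaban1987RG1] (0.1) p.251.
-/

set_option autoImplicit false

noncomputable section

open scoped BigOperators InnerProductSpace

namespace Summit.QuantumFields.YangMills.Theorems.K0Stub1MultiplierO1LetterAtRecord

open K0FlatPortBudgetsP (theta_budget chart_params)
open K0FlatPortKernelRowsP (unitWeights_pos globalBand_unitWeights)
open Literature.MathematicalPhysics.QuantumFieldTheory.Balaban1983to89
open Literature.MathematicalPhysics.QuantumFieldTheory.Balaban1983to89.T4Continuum (T4Family)
open B6MultiLevelBoxOperator (N0)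
open B6MultiLevelTorusOperatorL0 (TDomains)
open B6Geom246MultiLevelBoxL0 (bset)
open B6Geom246MultiLevelTorusL0 (geomT lemma21_torus)
open B6GlobalChartV1 (PV)
open B6GlobalChartV1L0 (domT)
open B6Ineq2142KLevelV1L0 (lvl lvl_le β)
open B6RandomWalk (delta3 delta3_pos)
open B6Ineq261LevelGap (K261 K261_nonneg)
open B6Ineq281MultiLevelBox (Kprof)
open B6SectADomainsV1 (Domains)
open B6SectAOperatorsV1 (BondIdx BondIdxSpace aE)
open B6SectAVectorModelV1 (EE)
open B6Prop27KLevelV1L0 (lam lam_pos lam_sq wt aE_single rho rho_sumBound)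
open B6Prop23MultiLevelTorusL0 (sumBound_torus)
open B6QGQCoerciveKLevelV1 (gam0 gam0_pos)
open FlatPortProp27PadL0 (prop27_kLevel_pad)
open Summit.QuantumFields.YangMills.Theorems.FlatCubeOpsText (Adm22)
open Summit.QuantumFields.YangMills.Theorems.K0Stub1MultiplierNormalisation (EE_sub_aE_eq_of_weights)

/-! ## §0  Bookkeeping: the length factors against the output weight, the diagonal, kernel sums -/

/-- the square of the length-factor bookkeeping: with `η = (Lᵏ)⁻¹`, `j_s ≤ k`, `D = e + 2` and `v²(L^{j_t}η)^{e} ≤ 1`: `v²·(η^{D})²·wt_t⁻¹·wt_s⁻¹ ≤ 1`, where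
`wt_j = (Lʲ/Lᵏ)²·((L^{D})^{j})⁻¹` ([B6] (2.142): `wt⁻¹ = (Lᵏ)²(Lʲ)^{D−2}`). [cite: Balaban1984PropagatorsII, (2.142) p.248, (2.149) p.249 (bookkeeping)] -/
theorem sq_weight_eta_invWt_le {Lr v : ℝ} {e k jt js : ℕ} (hL : 1 ≤ Lr) (hjs : js ≤ k) (hvb : v ^ 2 * (Lr ^ jt * (Lr⁻¹) ^ k) ^ e ≤ 1) :
    v ^ 2 * (((Lr⁻¹) ^ k) ^ (e + 2)) ^ 2 * ((Lr ^ jt / Lr ^ k) ^ 2 * ((Lr ^ (e + 2)) ^ jt)⁻¹)⁻¹ *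
      ((Lr ^ js / Lr ^ k) ^ 2 * ((Lr ^ (e + 2)) ^ js)⁻¹)⁻¹ ≤ 1 := by
  have hL0 : 0 < Lr := lt_of_lt_of_le zero_lt_one hL
  have hc0 : 0 < Lr ^ k := pow_pos hL0 k
  have hηc : (Lr⁻¹) ^ k * Lr ^ k = 1 := by rw [inv_pow, inv_mul_cancel₀ hc0.ne']
  have epow : ∀ j : ℕ, (Lr ^ (e + 2)) ^ j = (Lr ^ j) ^ (e + 2) := fun j => by rw [← pow_mul, ← pow_mul, mul_comm]
  have hx : ((Lr ^ jt / Lr ^ k) ^ 2 * ((Lr ^ (e + 2)) ^ jt)⁻¹)⁻¹ = (Lr ^ k) ^ 2 * (Lr ^ jt) ^ e := by rw [epow]; field_simp; ring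
  have hy : ((Lr ^ js / Lr ^ k) ^ 2 * ((Lr ^ (e + 2)) ^ js)⁻¹)⁻¹ = (Lr ^ k) ^ 2 * (Lr ^ js) ^ e := by rw [epow]; field_simp; ring
  have hyη : Lr ^ js * (Lr⁻¹) ^ k ≤ 1 := by rw [inv_pow, ← div_eq_mul_inv, div_le_one hc0]; exact pow_le_pow_right₀ hL hjs
  rw [hx, hy]
  calc v ^ 2 * (((Lr⁻¹) ^ k) ^ (e + 2)) ^ 2 * ((Lr ^ k) ^ 2 * (Lr ^ jt) ^ e) * ((Lr ^ k) ^ 2 * (Lr ^ js) ^ e)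
      = (v ^ 2 * (Lr ^ jt * (Lr⁻¹) ^ k) ^ e) * (Lr ^ js * (Lr⁻¹) ^ k) ^ e * ((Lr⁻¹) ^ k * Lr ^ k) ^ 4 := by ring
    _ ≤ 1 * 1 * 1 ^ 4 := by rw [hηc]; exact mul_le_mul_of_nonneg_right (mul_le_mul hvb (pow_le_one₀ (by positivity) hyη) (by positivity) zero_le_one) (by norm_num)
    _ = 1 := by norm_num

/-- **THE LENGTH FACTORS AGAINST THE OUTPUT WEIGHT**: `v·η^{D}·Λ_t⁻¹·Λ_s⁻¹ ≤ 1` whenever `Λ² = wt` as above, `v ≥ 0`, `v²(L^{j_t}η)^{D−2} ≤ 1`, `j_s ≤ k`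
(print: `Λ_t⁻¹Λ_s⁻¹ = η^{−D}(L^{j_t}η)^{(D−2)/2}(L^{j_s}η)^{(D−2)/2}`). [cite: Balaban1984PropagatorsII, (2.149) p.249, (2.81) p.237 (bookkeeping)] -/
theorem weight_eta_invLam_le {Lr v lt ls : ℝ} {e k jt js : ℕ} (hL : 1 ≤ Lr) (hjs : js ≤ k) (hv : 0 ≤ v)
    (hvb : v ^ 2 * (Lr ^ jt * (Lr⁻¹) ^ k) ^ e ≤ 1) (hlt : 0 < lt) (hls : 0 < ls)
    (hlt2 : lt ^ 2 = (Lr ^ jt / Lr ^ k) ^ 2 * ((Lr ^ (e + 2)) ^ jt)⁻¹) (hls2 : ls ^ 2 = (Lr ^ js / Lr ^ k) ^ 2 * ((Lr ^ (e + 2)) ^ js)⁻¹) :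
    v * ((Lr⁻¹) ^ k) ^ (e + 2) * lt⁻¹ * ls⁻¹ ≤ 1 := by
  have hL0 : 0 < Lr := lt_of_lt_of_le zero_lt_one hL
  refine (sq_le_one_iff₀ (by positivity)).1 ?_
  have h := sq_weight_eta_invWt_le (e := e) hL hjs hvb
  rw [← hlt2, ← hls2] at h
  calc (v * ((Lr⁻¹) ^ k) ^ (e + 2) * lt⁻¹ * ls⁻¹) ^ 2 = v ^ 2 * (((Lr⁻¹) ^ k) ^ (e + 2)) ^ 2 * (lt ^ 2)⁻¹ * (ls ^ 2)⁻¹ := by ring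
    _ ≤ 1 := h

/-- **THE DIAGONAL AGAINST THE OUTPUT WEIGHT**: `v·η^{D}·a(t) ≤ 1` for the port's band weight `a(t) = (Lᵏ/L^{j_t})²·(L^{j_t})^{D}` (`= η^{−D}(L^{j_t}η)^{D−2}`),
`v ≥ 0`, `v²(L^{j_t}η)^{D−2} ≤ 1`, `j_t ≤ k`. [cite: Balaban1984PropagatorsII, (2.16) p.225 (bookkeeping)] -/
theorem weight_eta_band_le {Lr v : ℝ} {e k jt : ℕ} (hL : 1 ≤ Lr) (hjt : jt ≤ k) (hv : 0 ≤ v) (hvb : v ^ 2 * (Lr ^ jt * (Lr⁻¹) ^ k) ^ e ≤ 1) :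
    v * ((Lr⁻¹) ^ k) ^ (e + 2) * ((Lr ^ k / Lr ^ jt) ^ 2 * (Lr ^ jt) ^ (e + 2)) ≤ 1 := by
  have hL0 : 0 < Lr := lt_of_lt_of_le zero_lt_one hL
  have hc0 : 0 < Lr ^ k := pow_pos hL0 k
  have hηc : (Lr⁻¹) ^ k * Lr ^ k = 1 := by rw [inv_pow, inv_mul_cancel₀ hc0.ne']
  have hxη : Lr ^ jt * (Lr⁻¹) ^ k ≤ 1 := by rw [inv_pow, ← div_eq_mul_inv, div_le_one hc0]; exact pow_le_pow_right₀ hL hjt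
  have e1 : v * ((Lr⁻¹) ^ k) ^ (e + 2) * ((Lr ^ k / Lr ^ jt) ^ 2 * (Lr ^ jt) ^ (e + 2)) = v * (Lr ^ jt * (Lr⁻¹) ^ k) ^ e * ((Lr⁻¹) ^ k * Lr ^ k) ^ 2 := by
    field_simp; ring
  rw [e1, hηc, one_pow, mul_one]
  refine (sq_le_one_iff₀ (by positivity)).1 ?_
  calc (v * (Lr ^ jt * (Lr⁻¹) ^ k) ^ e) ^ 2 = (v ^ 2 * (Lr ^ jt * (Lr⁻¹) ^ k) ^ e) * (Lr ^ jt * (Lr⁻¹) ^ k) ^ e := by ring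
    _ ≤ 1 := (mul_le_mul hvb (pow_le_one₀ (by positivity) hxη) (by positivity) zero_le_one).trans_eq (one_mul 1)

/-- **KERNEL SUMS IN A NORMED `ℂ`-SPACE**: `‖Σ_s (m_s : ℂ)•X_s‖ ≤ (Σ_s |m_s|)·S` for `‖X_s‖ ≤ S`. [folklore] -/
theorem norm_kernel_smul_sum_le {ι : Type*} [Fintype ι] {V : Type*} [SeminormedAddCommGroup V] [NormedSpace ℂ V]
    (m : ι → ℝ) (X : ι → V) {S : ℝ} (hX : ∀ s, ‖X s‖ ≤ S) : ‖∑ s, ((m s : ℝ) : ℂ) • X s‖ ≤ (∑ s, |m s|) * S := by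
  calc ‖∑ s, ((m s : ℝ) : ℂ) • X s‖ ≤ ∑ s, ‖((m s : ℝ) : ℂ) • X s‖ := norm_sum_le _ _
    _ = ∑ s, |m s| * ‖X s‖ := Finset.sum_congr rfl fun s _ => by rw [norm_smul, Complex.norm_real, Real.norm_eq_abs]
    _ ≤ ∑ s, |m s| * S := Finset.sum_le_sum fun s _ => mul_le_mul_of_nonneg_left (hX s) (abs_nonneg _)
    _ = (∑ s, |m s|) * S := (Finset.sum_mul _ _ _).symm

/-! ## §1  ★★ The row sum of `η^{D}·((QGQ*)⁻¹ − a)` against the output weight, at every charted family -/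

section Carrier

variable {d ℓ m K : ℕ} {hd : 1 ≤ d + 1} {hL : Odd (ℓ + 1) ∧ 1 < ℓ + 1} {Mh k R : ℕ} {P' : Fin (d + 1) → ℕ}
variable (hN : ∀ μ, N0 ℓ Mh k P' μ = (PV d ℓ m K hd hL).sitesPerDir 0) (D : TDomains d ℓ Mh k P' R) (hk : k ≤ m + K)

/-- **THE KERNEL OF `E − a` AGAINST `E`'s**: `|((EE − aE w)e_s)(t)| ≤ |⟪e_t, EE e_s⟫| + w_s·[t = s]` (`aE w e_s = w_s•e_s`).
[cite: Balaban1984PropagatorsII, (2.7) p.224, (2.35) p.228 (bookkeeping)] -/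
theorem abs_kernel_sub_diag_le {cf : ℝ} (hcf : cf ≠ 0) {w : BondIdx (domT hN D hk) → ℝ} (hw : ∀ i, 0 < w i) (s t : BondIdx (domT hN D hk)) :
    |WithLp.ofLp ((EE (domT hN D hk) hcf hw - aE (domT hN D hk) w) (WithLp.toLp 2 (Pi.single s 1))) t| ≤
      |⟪EuclideanSpace.single t (1 : ℝ), EE (domT hN D hk) hcf hw (EuclideanSpace.single s (1 : ℝ))⟫_ℝ| + w s * (if t = s then 1 else 0) := by
  classical
  have h1 : WithLp.ofLp ((EE (domT hN D hk) hcf hw - aE (domT hN D hk) w) (WithLp.toLp 2 (Pi.single s 1))) t =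
      ⟪EuclideanSpace.single t (1 : ℝ), (EE (domT hN D hk) hcf hw - aE (domT hN D hk) w) (EuclideanSpace.single s (1 : ℝ))⟫_ℝ := by
    rw [EuclideanSpace.inner_single_left]; simp
  have h2 : ⟪EuclideanSpace.single t (1 : ℝ), (EE (domT hN D hk) hcf hw - aE (domT hN D hk) w) (EuclideanSpace.single s (1 : ℝ))⟫_ℝ =
      ⟪EuclideanSpace.single t (1 : ℝ), EE (domT hN D hk) hcf hw (EuclideanSpace.single s (1 : ℝ))⟫_ℝ - w s * (if t = s then 1 else 0) := by
    rw [LinearMap.sub_apply, inner_sub_right, aE_single hN D hk w s, real_inner_smul_right]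
    congr 1
    rw [EuclideanSpace.inner_single_left]
    by_cases hts : t = s
    · subst hts; simp
    · rw [if_neg hts]; simp [hts]
  rw [h1, h2]
  have h3 : 0 ≤ w s * (if t = s then (1 : ℝ) else 0) := mul_nonneg (hw s).le (by split_ifs <;> norm_num)
  exact (abs_sub _ _).trans_eq (by rw [abs_of_nonneg h3])

end Carrier

/-- ★★ **THE ROW SUM OF `η^{D}·((QGQ*)⁻¹ − a)` AT A CHARTED FAMILY, AGAINST ANY OUTPUT WEIGHT IN THE BAND** (the `O₁` letter's real core): for odd `L = ℓ + 1 ≥ 5`,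
`D = d + 1 ≥ 2` there are `Mh₀, R₀` and `O₁ ≥ 0` (functions of `d, L`) such that in the standing range (`1 ≤ K − n`, `K − n + 1 ≤ m + K`, `M_h = Lᵃ ≥ Mh₀`, `R ≥ R₀`,
`P′ = L·P″`, `P″ ≥ 5`), for ANY positive auxiliary weights `w` (canonicity of `(QGQ*)⁻¹ − a`), every output weight `v ≥ 0` with `v(t)²·(L^{j(t)}η)^{d−1} ≤ 1` and every
index bond `t`: `v(t)·η^{D}·Σ_s |((EE − aE w)e_s)(t)| ≤ O₁` (`η = L^{−(K−n)}`; (2.149) at the port pad's unit band for the entries, the length factors of §0, Lemma 2.1 on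
the torus at rate `16δ₄`, `α = 1∕16` + the fibre count `2D`; `O₁ = (2∕γ₀)·2D·K₂.₆₁ + 1`). [cite: Balaban1984PropagatorsII, Prop. 2.7 (2.149) p.249, (2.142)-(2.147) p.248, Lemma 2.1 (2.59)-(2.61) pp.233-234, (2.35) p.228, (2.16) p.225; Balaban1983RegularityDecay, (5.7)-(5.9) pp.594-595] -/
theorem multiplierRowSum_domT (d ℓ : ℕ) (hd : 1 ≤ d + 1) (hL : Odd (ℓ + 1) ∧ 1 < ℓ + 1) (hℓ : 4 ≤ ℓ) (hd1 : 1 ≤ d) :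
    ∃ (Mh₀ R₀ : ℕ) (O₁ : ℝ), 0 ≤ O₁ ∧
    ∀ (m : ℕ) (n K : ℕ) {Mh R : ℕ} {P' : Fin (d + 1) → ℕ} (hN : ∀ μ, N0 ℓ Mh (K - n) P' μ = (PV d ℓ m K hd hL).sitesPerDir 0)
      (D : TDomains d ℓ Mh (K - n) P' R) (hk : K - n ≤ m + K) (_ : 1 ≤ K - n) (_ : K - n + 1 ≤ m + K)
      {P'' : Fin (d + 1) → ℕ} (_ : ∀ μ, P' μ = (ℓ + 1) * P'' μ) (_ : ∀ μ, 5 ≤ P'' μ)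
      {a : ℕ} (_ : Mh = (ℓ + 1) ^ a) (_ : Mh₀ ≤ Mh) (_ : R₀ ≤ R)
      (hcf : (((ℓ + 1 : ℕ) : ℝ)) ^ (K - n) ≠ 0) {w : BondIdx (domT hN D hk) → ℝ} (hw : ∀ i, 0 < w i)
      (v : BondIdx (domT hN D hk) → ℝ) (_ : ∀ t, 0 ≤ v t)
      (_ : ∀ t, v t ^ 2 * ((((ℓ + 1 : ℕ) : ℝ)) ^ (t.1.1 : ℕ) * ((((ℓ + 1 : ℕ) : ℝ))⁻¹) ^ (K - n)) ^ (d - 1) ≤ 1)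
      (t : BondIdx (domT hN D hk)),
      v t * (((((ℓ + 1 : ℕ) : ℝ))⁻¹) ^ (K - n)) ^ (d + 1) *
        ∑ s, |WithLp.ofLp ((EE (domT hN D hk) hcf hw - aE (domT hN D hk) w) (WithLp.toLp 2 (Pi.single s 1))) t| ≤ O₁ := by
  classical
  obtain ⟨e, rfl⟩ : ∃ e, d = e + 1 := ⟨d - 1, by omega⟩
  -- [B6] Prop. 2.7 (2.149) at the unit band `b₀ = b₁ = 1` (port pad); its rate `δ₄`
  obtain ⟨σb, hσb, hB⟩ := prop27_kLevel_pad (e + 1) ℓ hd hL one_pos (le_refl (1 : ℝ))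
  obtain ⟨A', M₂b, cc, N₁b, hA', hM₂b, hcc, hrowsB⟩ := hB σb hσb le_rfl (1 / 2) (by norm_num) (by norm_num)
  set δ₃ : ℝ := delta3 (1 / 2) (2 * σb) with hδ₃
  have hδ₃0 : 0 < δ₃ := delta3_pos (by norm_num) (by linarith)
  set γ₀ : ℝ := gam0 (e + 1) ℓ 1 with hγ₀
  have hγ₀0 : 0 < γ₀ := gam0_pos (e + 1) ℓ zero_le_one
  have hCγ0 : (0 : ℝ) ≤ 2 / γ₀ := div_nonneg zero_le_two hγ₀0.le
  set δ₄ : ℝ := min (δ₃ / 4) (γ₀ / A' / (2 * (1 * (4 / δ₃) * (2 * (((e + 1 : ℕ) : ℝ) + 1) * cc)) + 1)) with hδ₄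
  have hδ₄0 : 0 < δ₄ := lt_min (by linarith) (div_pos (div_pos hγ₀0 hA') (by positivity))
  -- Lemma 2.1 budget at `(δ₀, α) = (16δ₄, 1/16)`; the constant; the thresholds
  obtain ⟨hNpos, hθ⟩ := theta_budget (e + 1) ℓ (show 0 < 1 / 16 * (16 * δ₄) by positivity)
  set Nr : ℕ := ⌈2 * ((e + 1 + 1 : ℕ) : ℝ) * Real.log ((ℓ : ℝ) + 1) / (1 / 16 * (16 * δ₄))⌉₊ + 1 with hNr
  set Lr : ℝ := (ℓ : ℝ) + 1 with hLr
  have hL1 : (1 : ℝ) ≤ Lr := by rw [hLr]; linarith [(Nat.cast_nonneg ℓ : (0 : ℝ) ≤ ℓ)]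
  set c261 : ℝ := K261 Nr (e + 1 + 1) Lr 1 (1 / 16 * (16 * δ₄)) with hc261
  have hc261_0 : 0 ≤ c261 := K261_nonneg (by linarith : (0 : ℝ) ≤ Lr) zero_le_one
  set Mh₀ : ℕ := max 8 ⌈M₂b⌉₊ with hMh₀
  set R₀ : ℕ := max (2 * (ℓ + 1) ^ 2) (max (N₁b + 1) (Nr + 1)) with hR₀
  refine ⟨Mh₀, R₀, 2 / γ₀ * (2 * (((e + 1 : ℕ) : ℝ) + 1) * c261) + 1, by positivity, ?_⟩
  intro m n K Mh R P' hN D hk hk1 hk' P'' hLP hP5 a hMha hMh hR hcf w hw v hv0 hvb t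
  have hM8 : 8 ≤ Mh := le_trans (le_max_left _ _) hMh
  have hMh1 : 1 ≤ Mh := le_trans (by norm_num) hM8
  have hR2 : 2 * (ℓ + 1) ^ 2 ≤ R := le_trans (le_max_left _ _) hR
  have hRLM : ∀ {N₁ : ℕ}, N₁ + 1 ≤ R₀ → N₁ + 1 ≤ R * ((ℓ + 1) * Mh) := fun {N₁} h =>
    le_trans (le_trans h hR) (Nat.le_mul_of_pos_right R (Nat.mul_pos (Nat.succ_pos ℓ) (by omega)))
  have hN₁b' : N₁b + 1 ≤ R * ((ℓ + 1) * Mh) := hRLM (le_trans (le_trans (le_max_left _ _) (le_max_right _ _)) le_rfl)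
  have hNr' : Nr + 1 ≤ R * ((ℓ + 1) * Mh) := hRLM (le_trans (le_trans (le_max_right _ _) (le_max_right _ _)) le_rfl)
  have hM₂b' : M₂b ≤ ((ℓ : ℝ) + 1) * Mh := by
    have h2 : (⌈M₂b⌉₊ : ℝ) ≤ (Mh : ℝ) := by exact_mod_cast le_trans (le_max_right _ _) hMh
    linarith [Nat.le_ceil M₂b, le_mul_of_one_le_left (Nat.cast_nonneg _ : (0 : ℝ) ≤ Mh) hL1]
  have hP1 : ∀ μ, 1 ≤ P' μ := fun μ => by rw [hLP μ]; exact Nat.mul_pos (Nat.succ_pos ℓ) (by have := hP5 μ; omega)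
  -- the port's band weights; (2.149) at these data
  set ws : BondIdx (domT hN D hk) → ℝ := fun i =>
    ((((ℓ + 1 : ℕ) : ℝ)) ^ (K - n) / (((ℓ + 1 : ℕ) : ℝ)) ^ (i.1.1 : ℕ)) ^ 2 * ((((ℓ + 1 : ℕ) : ℝ)) ^ (i.1.1 : ℕ)) ^ (e + 1 + 1) with hws_def
  have hws : ∀ i, 0 < ws i := unitWeights_pos (e + 1) ℓ hd hL m n K hN D hk
  have h2149 := hrowsB m K hN D hk hk1 hk' hLP hP5 hMha hM8 hR2 hℓ hM₂b' hN₁b' hcf hws (globalBand_unitWeights (e + 1) ℓ hd hL m n K hN D hk)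
  -- Lemma 2.1 on the torus and the fibre count: the row sum of the profile
  obtain ⟨-, h261, -, -⟩ := lemma21_torus (D := D) hMh1 hP1 hNpos hNr' (δ₀ := 16 * δ₄) (α := 1 / 16) (by positivity)
    (by norm_num) (by norm_num) hθ
  have hrow : ∑ s, Real.exp (-(δ₄ * rho hN D hk t s)) ≤ 2 * (((e + 1 : ℕ) : ℝ) + 1) * c261 := by
    have h : ∑ s, Real.exp (-(δ₄ * rho hN D hk t s)) ≤
        2 * (((e + 1 : ℕ) : ℝ) + 1) * Kprof (16 * δ₄) c261 (Fintype.card ↥(bset D.toDomains)) δ₄ :=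
      rho_sumBound hN D hk (sumBound_torus (D := D) hMh1 hP1 h261) δ₄ hδ₄0 t
    rwa [show Kprof (16 * δ₄) c261 (Fintype.card ↥(bset D.toDomains)) δ₄ = c261 by unfold Kprof; rw [if_pos (by linarith)]] at h
  -- canonicity: `E_w − w = E_{ws} − ws`; then the entries one by one
  rw [EE_sub_aE_eq_of_weights (domT hN D hk) hcf hw hws]
  have hLr1 : (1 : ℝ) ≤ ((ℓ + 1 : ℕ) : ℝ) := by exact_mod_cast Nat.succ_le_succ (Nat.zero_le ℓ)
  have hη0 : 0 ≤ (((((ℓ + 1 : ℕ) : ℝ))⁻¹) ^ (K - n)) ^ (e + 1 + 1) := by positivity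
  have hvη : 0 ≤ v t * (((((ℓ + 1 : ℕ) : ℝ))⁻¹) ^ (K - n)) ^ (e + 1 + 1) := mul_nonneg (hv0 t) hη0
  have hjt : (t.1.1 : ℕ) ≤ K - n := lvl_le hN D hk t
  have hvb' : v t ^ 2 * ((((ℓ + 1 : ℕ) : ℝ)) ^ (t.1.1 : ℕ) * ((((ℓ + 1 : ℕ) : ℝ))⁻¹) ^ (K - n)) ^ e ≤ 1 := by simpa using hvb t
  have hent : ∀ s, v t * (((((ℓ + 1 : ℕ) : ℝ))⁻¹) ^ (K - n)) ^ (e + 1 + 1) *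
      |WithLp.ofLp ((EE (domT hN D hk) hcf hws - aE (domT hN D hk) ws) (WithLp.toLp 2 (Pi.single s 1))) t| ≤
      2 / γ₀ * Real.exp (-(δ₄ * rho hN D hk t s)) + (if t = s then 1 else 0) := by
    intro s
    -- the `E`-entry: (2.149) and the length factors
    have hfac : v t * (((((ℓ + 1 : ℕ) : ℝ))⁻¹) ^ (K - n)) ^ (e + 1 + 1) * (lam hN D hk ((((ℓ + 1 : ℕ) : ℝ)) ^ (K - n)) t)⁻¹ *
        (lam hN D hk ((((ℓ + 1 : ℕ) : ℝ)) ^ (K - n)) s)⁻¹ ≤ 1 :=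
      weight_eta_invLam_le (e := e) hLr1 (lvl_le hN D hk s) (hv0 t) hvb' (lam_pos hN D hk hcf t) (lam_pos hN D hk hcf s)
        (by rw [lam_sq hN D hk hcf t]; rfl) (by rw [lam_sq hN D hk hcf s]; rfl)
    have hE : v t * (((((ℓ + 1 : ℕ) : ℝ))⁻¹) ^ (K - n)) ^ (e + 1 + 1) *
        |⟪EuclideanSpace.single t (1 : ℝ), EE (domT hN D hk) hcf hws (EuclideanSpace.single s (1 : ℝ))⟫_ℝ| ≤ 2 / γ₀ * Real.exp (-(δ₄ * rho hN D hk t s)) := by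
      refine (mul_le_mul_of_nonneg_left (h2149 t s) hvη).trans ?_
      calc v t * (((((ℓ + 1 : ℕ) : ℝ))⁻¹) ^ (K - n)) ^ (e + 1 + 1) *
            ((lam hN D hk ((((ℓ + 1 : ℕ) : ℝ)) ^ (K - n)) t)⁻¹ * (lam hN D hk ((((ℓ + 1 : ℕ) : ℝ)) ^ (K - n)) s)⁻¹ *
              (2 / γ₀ * Real.exp (-(δ₄ * (geomT D).dist (β hN D hk t) (β hN D hk s)))))
          = (v t * (((((ℓ + 1 : ℕ) : ℝ))⁻¹) ^ (K - n)) ^ (e + 1 + 1) * (lam hN D hk ((((ℓ + 1 : ℕ) : ℝ)) ^ (K - n)) t)⁻¹ *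
              (lam hN D hk ((((ℓ + 1 : ℕ) : ℝ)) ^ (K - n)) s)⁻¹) * (2 / γ₀ * Real.exp (-(δ₄ * rho hN D hk t s))) := by simp only [rho]; ring
        _ ≤ _ := (mul_le_mul_of_nonneg_right hfac (mul_nonneg hCγ0 (Real.exp_pos _).le)).trans_eq (one_mul _)
    -- the diagonal
    have hA : v t * (((((ℓ + 1 : ℕ) : ℝ))⁻¹) ^ (K - n)) ^ (e + 1 + 1) * (ws s * (if t = s then 1 else 0)) ≤ (if t = s then 1 else 0) := by
      by_cases hts : t = s
      · subst hts; rw [if_pos rfl, mul_one]; exact weight_eta_band_le (e := e) hLr1 hjt (hv0 t) hvb'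
      · rw [if_neg hts, mul_zero, mul_zero]
    calc v t * (((((ℓ + 1 : ℕ) : ℝ))⁻¹) ^ (K - n)) ^ (e + 1 + 1) *
          |WithLp.ofLp ((EE (domT hN D hk) hcf hws - aE (domT hN D hk) ws) (WithLp.toLp 2 (Pi.single s 1))) t|
        ≤ v t * (((((ℓ + 1 : ℕ) : ℝ))⁻¹) ^ (K - n)) ^ (e + 1 + 1) *
          (|⟪EuclideanSpace.single t (1 : ℝ), EE (domT hN D hk) hcf hws (EuclideanSpace.single s (1 : ℝ))⟫_ℝ| + ws s * (if t = s then 1 else 0)) :=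
          mul_le_mul_of_nonneg_left (abs_kernel_sub_diag_le hN D hk hcf hws s t) hvη
      _ = v t * (((((ℓ + 1 : ℕ) : ℝ))⁻¹) ^ (K - n)) ^ (e + 1 + 1) *
            |⟪EuclideanSpace.single t (1 : ℝ), EE (domT hN D hk) hcf hws (EuclideanSpace.single s (1 : ℝ))⟫_ℝ| +
          v t * (((((ℓ + 1 : ℕ) : ℝ))⁻¹) ^ (K - n)) ^ (e + 1 + 1) * (ws s * (if t = s then 1 else 0)) := by ring
      _ ≤ _ := add_le_add hE hA
  -- the row sum
  calc v t * (((((ℓ + 1 : ℕ) : ℝ))⁻¹) ^ (K - n)) ^ (e + 1 + 1) *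
        ∑ s, |WithLp.ofLp ((EE (domT hN D hk) hcf hws - aE (domT hN D hk) ws) (WithLp.toLp 2 (Pi.single s 1))) t|
      = ∑ s, v t * (((((ℓ + 1 : ℕ) : ℝ))⁻¹) ^ (K - n)) ^ (e + 1 + 1) *
          |WithLp.ofLp ((EE (domT hN D hk) hcf hws - aE (domT hN D hk) ws) (WithLp.toLp 2 (Pi.single s 1))) t| := Finset.mul_sum _ _ _
    _ ≤ ∑ s, (2 / γ₀ * Real.exp (-(δ₄ * rho hN D hk t s)) + (if t = s then 1 else 0)) := Finset.sum_le_sum fun s _ => hent s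
    _ = 2 / γ₀ * ∑ s, Real.exp (-(δ₄ * rho hN D hk t s)) + 1 := by rw [Finset.sum_add_distrib, Finset.mul_sum, Finset.sum_ite_eq]; simp
    _ ≤ 2 / γ₀ * (2 * (((e + 1 : ℕ) : ℝ) + 1) * c261) + 1 := by have := mul_le_mul_of_nonneg_left hrow hCγ0; linarith

/-! ## §2  ★★ Every `Adm22` family of the P2 text (level-0 chart) -/

/-- ★★ **THE ROW SUM OF `η^{D}·((QGQ*)⁻¹ − a)` AT EVERY ADMISSIBLE FAMILY — NO `Ω₁ = T` HYPOTHESIS** (level-0 chart `FlatPortChartL0.tdOfAdmL0` ∕ `domT_tdOfAdmL0`, as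
`K0FlatPortKernelRowsP.kernelRowsAt_of_adm22`): for odd `L = ℓ + 1 ≥ 5`, `D = d + 1 ≥ 2` there are `Mh₀, R₀`, `O₁ ≥ 0` such that for `1 ≤ K − n`, `K − n + 1 ≤ m + K`,
`M = L·M_h`, `M_h = L^{a′} ≥ Mh₀`, `R ≥ R₀`, `a′ + 3 ≤ m + n`, every `D : Domains (PV d ℓ m K)` with `D.k = K − n`, `Adm22 D R (L·M_h)`, ANY weights `w > 0`, every output
weight `v ≥ 0` with `v(t)²(L^{j(t)}η)^{d−1} ≤ 1` and every `t`: `v(t)·η^{D}·Σ_s |((EE D − aE D w)e_s)(t)| ≤ O₁`. [cite: Balaban1984PropagatorsII, (2.1)-(2.2) p.224, Prop. 2.7 (2.149) p.249, Lemma 2.1 (2.61) p.234, (2.35) p.228] -/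
theorem multiplierRowSum_of_adm22 (d ℓ : ℕ) (hd : 1 ≤ d + 1) (hL : Odd (ℓ + 1) ∧ 1 < ℓ + 1) (hℓ : 4 ≤ ℓ) (hd1 : 1 ≤ d) :
    ∃ (Mh₀ R₀ : ℕ) (O₁ : ℝ), 0 ≤ O₁ ∧
    ∀ (m : ℕ) (n K : ℕ) (_ : 1 ≤ K - n) (_ : K - n + 1 ≤ m + K) {Mh R a' : ℕ} (_ : Mh = (ℓ + 1) ^ a') (_ : Mh₀ ≤ Mh) (_ : R₀ ≤ R)
      (_ : a' + 3 ≤ m + n) (D : Domains (PV d ℓ m K hd hL)) (hDk : D.k = K - n) (_ : Adm22 D R ((ℓ + 1) * Mh))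
      (hcf : (((ℓ + 1 : ℕ) : ℝ)) ^ (K - n) ≠ 0) {w : BondIdx D → ℝ} (hw : ∀ i, 0 < w i)
      (v : BondIdx D → ℝ) (_ : ∀ t, 0 ≤ v t)
      (_ : ∀ t, v t ^ 2 * ((((ℓ + 1 : ℕ) : ℝ)) ^ (t.1.1 : ℕ) * ((((ℓ + 1 : ℕ) : ℝ))⁻¹) ^ (K - n)) ^ (d - 1) ≤ 1)
      (t : BondIdx D),
      v t * (((((ℓ + 1 : ℕ) : ℝ))⁻¹) ^ (K - n)) ^ (d + 1) *
        ∑ s, |WithLp.ofLp ((EE D hcf hw - aE D w) (WithLp.toLp 2 (Pi.single s 1))) t| ≤ O₁ := by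
  obtain ⟨Mh₀, R₀, O₁, hO₁, hmain⟩ := multiplierRowSum_domT d ℓ hd hL hℓ hd1
  refine ⟨Mh₀, R₀, O₁, hO₁, ?_⟩
  intro m n K hk1 hk' Mh R a' hMha hMh hR hsize D hDk hAdm
  have hk : K - n ≤ m + K := by omega
  obtain ⟨hN, hLP, hP5⟩ := chart_params d ℓ m n K a' hd hL hℓ hk1 hsize
  rw [hMha] at hAdm
  have hN' : ∀ μ : Fin (d + 1), N0 ℓ Mh (K - n) (fun _ => 2 * (ℓ + 1) ^ (m + n - 1 - a')) μ = (PV d ℓ m K hd hL).sitesPerDir 0 := by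
    rw [hMha]; exact hN
  rw [← hMha] at hAdm
  set D' := FlatPortChartL0.tdOfAdmL0 hN' D hDk hk hAdm with hD'
  have hEq : domT hN' D' hk = D := FlatPortChartL0.domT_tdOfAdmL0 hN' D hDk hk hAdm
  rw [← hEq]
  exact hmain m n K hN' D' hk hk1 hk' hLP hP5 hMha hMh hR

/-! ## §3  NODE 00's four-tori: the row sum, and the capstone's `h3132` for `η^d•M_V` AS DISPLAYED -/

/-- **THE ROW SUM ON THE RECORD's TORI** (`T4Family.P K = PV 3 ℓ m K` by `rfl`; `D = 4`, so the band is `v(t)·(L^{j(t)}η) ≤ 1`): thresholds `Mh₀, R₀` and `O₁ ≥ 0`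
(functions of `L`) such that at every admissible family of `Site (F.P K) 0` in the standing range, ANY auxiliary weights `w > 0`, units `c = L^{K−n} = η⁻¹`, every output
weight in the band and every index bond `t`: `v(t)·η⁴·Σ_s |((EE D − aE D w)e_s)(t)| ≤ O₁`.
[cite: Balaban1984PropagatorsII, Prop. 2.7 (2.149) p.249, Lemma 2.1 (2.61) p.234, (2.35) p.228; Balaban1987RG1, (0.1) p.251] -/
theorem multiplierRowSum_of_adm22_T4 (F : T4Family) :
    ∃ (Mh₀ R₀ : ℕ) (O₁ : ℝ), 0 ≤ O₁ ∧
    ∀ (n K : ℕ) (_ : 1 ≤ K - n) (_ : K - n + 1 ≤ F.m + K) {Mh R a' : ℕ} (_ : Mh = F.L ^ a') (_ : Mh₀ ≤ Mh) (_ : R₀ ≤ R)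
      (_ : a' + 3 ≤ F.m + n) (D : Domains (F.P K)) (hDk : D.k = K - n) (_ : Adm22 D R (F.L * Mh))
      (hc : ((F.P K).L : ℝ) ^ (K - n) ≠ 0) {w : BondIdx D → ℝ} (hw : ∀ i, 0 < w i)
      (v : BondIdx D → ℝ) (_ : ∀ t, 0 ≤ v t) (_ : ∀ t, v t * (((F.P K).L : ℝ) ^ (t.1.1 : ℕ) * ((((F.P K).L : ℝ))⁻¹) ^ (K - n)) ≤ 1)
      (t : BondIdx D),
      v t * (((((F.P K).L : ℝ))⁻¹) ^ (K - n)) ^ (F.P K).d *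
        ∑ s, |WithLp.ofLp ((EE D hc hw - aE D w) (WithLp.toLp 2 (Pi.single s 1))) t| ≤ O₁ := by
  obtain ⟨L, hL, h11, m, hm⟩ := F
  obtain ⟨ℓ, rfl⟩ : ∃ ℓ, L = ℓ + 1 := ⟨L - 1, by omega⟩
  have hℓ : 4 ≤ ℓ := by omega
  obtain ⟨Mh₀, R₀, O₁, hO₁, hmain⟩ := multiplierRowSum_of_adm22 3 ℓ K0FlatCubeOpsTextP.hd4 hL hℓ (by norm_num)
  refine ⟨Mh₀, R₀, O₁, hO₁, ?_⟩
  intro n K hk1 hk' Mh R a' hMha hMh hR hsize D hDk hAdm hc w hw v hv0 hvb t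
  have hL0 : (0 : ℝ) < ((ℓ + 1 : ℕ) : ℝ) := by positivity
  refine hmain m n K hk1 hk' hMha hMh hR hsize D hDk hAdm hc hw v hv0 (fun t' => ?_) t
  -- the band in the squared form: `(v·(Lʲη))² ≤ 1`
  have hx0 : 0 ≤ (((ℓ + 1 : ℕ) : ℝ)) ^ (t'.1.1 : ℕ) * ((((ℓ + 1 : ℕ) : ℝ))⁻¹) ^ (K - n) := by positivity
  calc v t' ^ 2 * ((((ℓ + 1 : ℕ) : ℝ)) ^ (t'.1.1 : ℕ) * ((((ℓ + 1 : ℕ) : ℝ))⁻¹) ^ (K - n)) ^ (3 - 1)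
      = (v t' * ((((ℓ + 1 : ℕ) : ℝ)) ^ (t'.1.1 : ℕ) * ((((ℓ + 1 : ℕ) : ℝ))⁻¹) ^ (K - n))) ^ 2 := by norm_num; ring
    _ ≤ 1 := pow_le_one₀ (mul_nonneg (hv0 t') hx0) (hvb t')

/-- the scaled multiplier is `B`-symmetric with `M_V` (the capstone's `hMsym` for `η^d•M_V`). [folklore] -/
theorem smul_multiplier_symm {ι 𝔸 : Type*} [Fintype ι] [SeminormedAddCommGroup 𝔸] [NormedSpace ℂ 𝔸]
    (B : (ι → 𝔸) →L[ℂ] (ι → 𝔸) →L[ℂ] ℂ) (MV : (ι → 𝔸) →L[ℂ] (ι → 𝔸)) (hMsym : ∀ a b, B (MV a) b = B a (MV b)) (z : ℂ) (a b : ι → 𝔸) :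
    B ((z • MV) a) b = B a ((z • MV) b) := by
  rw [_root_.smul_apply, _root_.smul_apply, map_smul, map_smul, _root_.smul_apply, hMsym]

/-- ★★★ **THE CAPSTONE's `h3132` FOR `η^d•M_V` AT THE RECORD, EVERY OUTPUT BLOCK WEIGHT IN THE BAND** — for every `F : T4Family` there are `Mh₀, R₀` and ONE constant
`O₁ ≥ 0` such that at every admissible family of the record's tori in the standing range (as in `multiplierRowSum_of_adm22_T4`), for ANY auxiliary weights `w > 0`, units
`c = L^{K−n}`, every normed `ℂ`-space `𝔸` (e.g. `M_N(ℂ)`), every continuous linear `M_V` on `BondIdx D → 𝔸` with p598821's kernel formula and every `wB′ ≥ 0` with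
`wB′(t)·(L^{j(t)}η) ≤ 1`: `(∀ i, 1·‖X i‖ ≤ s) → ∀ t, wB′ t·‖((η^d•M_V) X) t‖ ≤ O₁·s`, `η = (L⁻¹)^{K−n}`, `d = (F.P K).d` — the binder `h3132` of
`K0Stub1SectFWSlotAtRecord.exists_sectF_W_atRecord_of_numericLetters` at `MV := ((η:ℂ)^d)•M_V` (k0-s1-w4's normalisation p612514) DISCHARGED.
[cite: Balaban1984PropagatorsII, Prop. 2.7 (2.149) p.249, Lemma 2.1 (2.59)-(2.61) pp.233-234, (2.35) p.228, (2.16) p.225; Balaban1985Variational, (27) p.282, (66) p.287, (87)-(88) p.291; Balaban1987RG1, (0.1) p.251] -/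
theorem h3132_of_adm22_T4 (F : T4Family) :
    ∃ (Mh₀ R₀ : ℕ) (O₁ : ℝ), 0 ≤ O₁ ∧
    ∀ (n K : ℕ) (_ : 1 ≤ K - n) (_ : K - n + 1 ≤ F.m + K) {Mh R a' : ℕ} (_ : Mh = F.L ^ a') (_ : Mh₀ ≤ Mh) (_ : R₀ ≤ R)
      (_ : a' + 3 ≤ F.m + n) (D : Domains (F.P K)) (hDk : D.k = K - n) (_ : Adm22 D R (F.L * Mh))
      (hc : ((F.P K).L : ℝ) ^ (K - n) ≠ 0) {w : BondIdx D → ℝ} (hw : ∀ i, 0 < w i)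
      {𝔸 : Type*} [SeminormedAddCommGroup 𝔸] [NormedSpace ℂ 𝔸]
      (MV : (BondIdx D → 𝔸) →L[ℂ] (BondIdx D → 𝔸))
      (_ : ∀ (X : BondIdx D → 𝔸) (t : BondIdx D),
        MV X t = ∑ s, ((WithLp.ofLp ((EE D hc hw - aE D w) (WithLp.toLp 2 (Pi.single s 1))) t : ℝ) : ℂ) • X s)
      (wB' : BondIdx D → ℝ) (_ : ∀ t, 0 ≤ wB' t) (_ : ∀ t, wB' t * (((F.P K).L : ℝ) ^ (t.1.1 : ℕ) * ((((F.P K).L : ℝ))⁻¹) ^ (K - n)) ≤ 1)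
      (X : BondIdx D → 𝔸) (s : ℝ) (_ : ∀ i, (1 : ℝ) * ‖X i‖ ≤ s) (t : BondIdx D),
      wB' t * ‖((((((((F.P K).L : ℝ))⁻¹) ^ (K - n) : ℝ) : ℂ) ^ (F.P K).d) • MV) X t‖ ≤ O₁ * s := by
  obtain ⟨Mh₀, R₀, O₁, hO₁, hmain⟩ := multiplierRowSum_of_adm22_T4 F
  refine ⟨Mh₀, R₀, O₁, hO₁, ?_⟩
  intro n K hk1 hk' Mh R a' hMha hMh hR hsize D hDk hAdm hc w hw 𝔸 _ _ MV hMV wB' hwB0 hwB X s hX t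
  have hs : 0 ≤ s := le_trans (by rw [one_mul]; exact norm_nonneg _) (hX t)
  have hX' : ∀ i, ‖X i‖ ≤ s := fun i => by have := hX i; rwa [one_mul] at this
  have hη0 : 0 ≤ ((((F.P K).L : ℝ))⁻¹) ^ (K - n) := by positivity
  have hrow := hmain n K hk1 hk' hMha hMh hR hsize D hDk hAdm hc hw wB' hwB0 hwB t
  -- `((η^d•M_V) X) t = η^d • Σ_s m(t,s)•X s`, norm `= η^d·‖Σ‖`
  rw [_root_.smul_apply, Pi.smul_apply, norm_smul, norm_pow, Complex.norm_real, Real.norm_eq_abs, abs_of_nonneg hη0, hMV X t]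
  calc wB' t * ((((((F.P K).L : ℝ))⁻¹) ^ (K - n)) ^ (F.P K).d *
        ‖∑ s', ((WithLp.ofLp ((EE D hc hw - aE D w) (WithLp.toLp 2 (Pi.single s' 1))) t : ℝ) : ℂ) • X s'‖)
      ≤ wB' t * ((((((F.P K).L : ℝ))⁻¹) ^ (K - n)) ^ (F.P K).d *
        ((∑ s', |WithLp.ofLp ((EE D hc hw - aE D w) (WithLp.toLp 2 (Pi.single s' 1))) t|) * s)) :=
          mul_le_mul_of_nonneg_left (mul_le_mul_of_nonneg_left (norm_kernel_smul_sum_le _ X hX') (pow_nonneg hη0 _)) (hwB0 t)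
    _ = (wB' t * (((((F.P K).L : ℝ))⁻¹) ^ (K - n)) ^ (F.P K).d *
        ∑ s', |WithLp.ofLp ((EE D hc hw - aE D w) (WithLp.toLp 2 (Pi.single s' 1))) t|) * s := by ring
    _ ≤ O₁ * s := mul_le_mul_of_nonneg_right hrow hs

/-- ★★★ **THE CAPSTONE's `h3132` FOR `η^d•M_V` AT THE RECORD, OUTPUT BLOCK WEIGHT `wB′ ≡ 1`** (the displayed shape of p612123 verbatim with `wB' := fun _ => 1`):
`(∀ i, 1·‖X i‖ ≤ s) → ∀ t, 1·‖((η^d•M_V) X) t‖ ≤ O₁·s`. [cite: Balaban1984PropagatorsII, Prop. 2.7 (2.149) p.249, Lemma 2.1 (2.61) p.234; Balaban1985Variational, (87)-(88) p.291; Balaban1987RG1, (0.1) p.251] -/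
theorem h3132_unitWeight_of_adm22_T4 (F : T4Family) :
    ∃ (Mh₀ R₀ : ℕ) (O₁ : ℝ), 0 ≤ O₁ ∧
    ∀ (n K : ℕ) (_ : 1 ≤ K - n) (_ : K - n + 1 ≤ F.m + K) {Mh R a' : ℕ} (_ : Mh = F.L ^ a') (_ : Mh₀ ≤ Mh) (_ : R₀ ≤ R)
      (_ : a' + 3 ≤ F.m + n) (D : Domains (F.P K)) (hDk : D.k = K - n) (_ : Adm22 D R (F.L * Mh))
      (hc : ((F.P K).L : ℝ) ^ (K - n) ≠ 0) {w : BondIdx D → ℝ} (hw : ∀ i, 0 < w i)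
      {𝔸 : Type*} [SeminormedAddCommGroup 𝔸] [NormedSpace ℂ 𝔸]
      (MV : (BondIdx D → 𝔸) →L[ℂ] (BondIdx D → 𝔸))
      (_ : ∀ (X : BondIdx D → 𝔸) (t : BondIdx D),
        MV X t = ∑ s, ((WithLp.ofLp ((EE D hc hw - aE D w) (WithLp.toLp 2 (Pi.single s 1))) t : ℝ) : ℂ) • X s)
      (X : BondIdx D → 𝔸) (s : ℝ) (_ : ∀ i, (1 : ℝ) * ‖X i‖ ≤ s) (t : BondIdx D),
      (fun _ : BondIdx D => (1 : ℝ)) t * ‖((((((((F.P K).L : ℝ))⁻¹) ^ (K - n) : ℝ) : ℂ) ^ (F.P K).d) • MV) X t‖ ≤ O₁ * s := by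
  obtain ⟨Mh₀, R₀, O₁, hO₁, hmain⟩ := h3132_of_adm22_T4 F
  refine ⟨Mh₀, R₀, O₁, hO₁, ?_⟩
  intro n K hk1 hk' Mh R a' hMha hMh hR hsize D hDk hAdm hc w hw 𝔸 _ _ MV hMV X s hX t
  have hL1 : (1 : ℝ) ≤ ((F.P K).L : ℝ) := by exact_mod_cast (F.P K).L_pos
  refine hmain n K hk1 hk' hMha hMh hR hsize D hDk hAdm hc hw MV hMV (fun _ => (1 : ℝ)) (fun _ => zero_le_one) (fun t' => ?_) X s hX t
  -- `1·(Lʲη) ≤ 1` since `j ≤ K − n`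
  have hj : (t'.1.1 : ℕ) ≤ K - n := (Nat.lt_succ_iff.1 t'.1.1.isLt).trans hDk.le
  have hL0 : (0 : ℝ) < ((F.P K).L : ℝ) ^ (K - n) := by positivity
  rw [one_mul, inv_pow, ← div_eq_mul_inv, div_le_one hL0]
  exact pow_le_pow_right₀ hL1 hj

end Summit.QuantumFields.YangMills.Theorems.K0Stub1MultiplierO1LetterAtRecord

end
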